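import Summits.Ventures.PercRepro.Night2FatZThreeB
import Summits.Ventures.PercRepro.Night2FatDegSingle

/-!
# night-2: the witnesses of the singly degenerate regime at small `N` — side points, free points, unloaded singletons — the preamble facts, part 3

**`exists_small_witnesses_deg`**: for every lossy basis pair of the singly degenerate regime there are sets `U` of side
points, `V` of free points and `E` of points on no non-class basis line (unloaded singletons) of `W ∖ {x}` in one of
four patterns: (α) the line of `M` is not a non-class basis line, `|U| = 2`, `|V| = 1`, `|E| ≥ 2`;
(β) `|U| = 1`, `|V| = 3`, `|E| ≥ 2`; (γ) `|U| = 2`, `|V| = 2`, `|E| ≥ 1`; (δ) `|U| = 1`, `|V| = 2`, `|E| ≥ 3`.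
Each pattern gives the fair share at `N = 6, 7, 8` (`Night2FatDegNumIccA/B`).  The case analysis follows
`exists_side_and_free_deg`: `|P₂| ∈ {0, 1, 2, 3}` basis points of `π₂` off the spine.
Paper `proofs/NIGHT-2-g35.md` §5.
-/

namespace PercRepro.Shadow

open PercRepro.ThmH PercRepro.PerFlat

variable {α : Type*} [DecidableEq α] {M : Matroid α} [M.Finite] {G : Finset α}

/-- A spine basis point coplanar with `M` and a basis point of `π₂` off the spine lies in `clF M`. -/
theorem deg_wit_spineM {w₀ x : α} {R₁ : Finset α} {c₂ c₃ : α} {B : Finset α} {z : α} (hd : (gr M \ G).card = 2)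
    (hk : kColoops M G = 1) (hs : ∀ e ∈ gr M, ∀ f ∈ gr M, e ≠ f → rkN M {e, f} = 2)
    (hfat : (fatClosures M 5 G 2).card ≤ 1) (hR₁2 : rkN M R₁ = 2) (hR₁3 : 3 ≤ R₁.card)
    (hcop : rkN M (insert w₀ (insert x R₁)) ≤ 3) (hc₂ : c₂ ∉ clF M R₁) (hc₃ : c₃ ∉ clF M (insert c₂ R₁))
    (hnd₂ : 3 ≤ rkN M (((G \ coloops M G) \ {w₀, x}).filter (fun e => e ∈ clF M (insert c₂ R₁) ∧ e ∉ clF M R₁)))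
    (hdeg₃ : rkN M (((G \ coloops M G) \ {w₀, x}).filter (fun e => e ∈ clF M (insert c₃ R₁) ∧ e ∉ clF M R₁)) ≤ 2)
    {V P W Mset P₃ M' L₀ P₂ Aset Lset : Finset α} (hV : V = (G \ coloops M G) \ {w₀, x})
    (hP : P = (insert z B \ coloops M G).erase w₀) (hW : W = (G \ insert z B).erase x)
    (hMset : Mset = V.filter (fun e => e ∈ clF M (insert c₃ R₁) ∧ e ∉ clF M R₁))
    (hP₃ : P₃ = P.filter (fun e => e ∈ Mset)) (hM' : M' = W.filter (fun e => e ∈ Mset))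
    (hL₀ : L₀ = P.filter (fun e => e ∈ clF M R₁))
    (hP₂ : P₂ = P.filter (fun e => e ∈ clF M (insert c₂ R₁) ∧ e ∉ clF M R₁))
    (hAset : Aset = V.filter (fun e => e ∈ clF M (insert c₂ R₁) ∧ e ∉ clF M R₁))
    (hLset : Lset = V.filter (fun e => e ∈ clF M R₁)) (hVg : V ⊆ gr M) (hPV : P ⊆ V) (hP4 : P.card = 4)
    (hR₁g : R₁ ⊆ gr M) (hc₂g : c₂ ∈ gr M) (hc₃g : c₃ ∈ gr M) (hc₃L : c₃ ∉ clF M R₁) (hM3 : 3 ≤ Mset.card)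
    (hM2 : 1 < Mset.card) (hP₃2 : P₃.card ≤ 2) (hMsplit : Mset.card = P₃.card + M'.card) (hM'1 : 1 ≤ M'.card)
    (hL₀2 : L₀.card ≤ 2) (hπ₂3 : (P.filter (fun e => e ∈ clF M (insert c₂ R₁))).card ≤ 3)
    (hL₀P₂ : L₀.card + P₂.card ≤ 3) (hsplit : L₀.card + P₂.card + P₃.card = 4) (hL3 : 3 ≤ Lset.card) :
    ∀ a ∈ L₀, ∀ c ∈ P₂, rkN M ({a, c} ∪ Mset) ≤ 3 → a ∈ clF M Mset := by
  subst hV hP hW hMset hP₃ hM' hL₀ hP₂ hAset hLset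
  set V := (G \ coloops M G) \ {w₀, x} with hV
  set P := (insert z B \ coloops M G).erase w₀ with hP
  set W := (G \ insert z B).erase x with hW
  set Mset := V.filter (fun e => e ∈ clF M (insert c₃ R₁) ∧ e ∉ clF M R₁) with hMset
  set P₃ := P.filter (fun e => e ∈ Mset) with hP₃
  set M' := W.filter (fun e => e ∈ Mset) with hM'
  set L₀ := P.filter (fun e => e ∈ clF M R₁) with hL₀
  set P₂ := P.filter (fun e => e ∈ clF M (insert c₂ R₁) ∧ e ∉ clF M R₁) with hP₂
  set Aset := V.filter (fun e => e ∈ clF M (insert c₂ R₁) ∧ e ∉ clF M R₁) with hAset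
  set Lset := V.filter (fun e => e ∈ clF M R₁) with hLset
  have _u := hd
  have _u := hk
  have _u := hfat
  have _u := hR₁2
  have _u := hR₁3
  have _u := hcop
  have _u := hnd₂
  have _u := hdeg₃
  have _u := hP4
  have _u := hM3
  have _u := hM2
  have _u := hP₃2
  have _u := hMsplit
  have _u := hM'1
  have _u := hL₀2
  have _u := hπ₂3
  have _u := hL₀P₂
  have _u := hsplit
  have _u := hL3
  intro a ha c hc hcopl
  have hc3 : c ∉ clF M (insert c₃ R₁) := by
    intro h
    exact (Finset.mem_filter.1 hc).2.2
      (mem_clF_of_mem_two_planes hR₁g hc₂g hc₃g hc₂ hc₃ (Finset.mem_filter.1 hc).2.1 h)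
  exact mem_clF_side_of_coplanar_of_spine_of_off hs hVg hR₁g hR₁2 hc₃g hc₃L hdeg₃ hM2
    (hVg (hPV (Finset.mem_filter.1 ha).1)) (Finset.mem_filter.1 ha).2 (hVg (hPV (Finset.mem_filter.1 hc).1)) hc3 hcopl

/-- A second side point of `W` when `|P₃| ≤ 1`. -/
theorem deg_wit_two {w₀ x : α} {R₁ : Finset α} {c₂ c₃ : α} {B : Finset α} {z : α} (hd : (gr M \ G).card = 2)
    (hk : kColoops M G = 1) (hfat : (fatClosures M 5 G 2).card ≤ 1) (hR₁2 : rkN M R₁ = 2) (hR₁3 : 3 ≤ R₁.card)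
    (hcop : rkN M (insert w₀ (insert x R₁)) ≤ 3)
    (hnd₂ : 3 ≤ rkN M (((G \ coloops M G) \ {w₀, x}).filter (fun e => e ∈ clF M (insert c₂ R₁) ∧ e ∉ clF M R₁)))
    (hdeg₃ : rkN M (((G \ coloops M G) \ {w₀, x}).filter (fun e => e ∈ clF M (insert c₃ R₁) ∧ e ∉ clF M R₁)) ≤ 2)
    {V P W Mset P₃ M' L₀ P₂ Aset Lset : Finset α} (hV : V = (G \ coloops M G) \ {w₀, x})
    (hP : P = (insert z B \ coloops M G).erase w₀) (hW : W = (G \ insert z B).erase x)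
    (hMset : Mset = V.filter (fun e => e ∈ clF M (insert c₃ R₁) ∧ e ∉ clF M R₁))
    (hP₃ : P₃ = P.filter (fun e => e ∈ Mset)) (hM' : M' = W.filter (fun e => e ∈ Mset))
    (hL₀ : L₀ = P.filter (fun e => e ∈ clF M R₁))
    (hP₂ : P₂ = P.filter (fun e => e ∈ clF M (insert c₂ R₁) ∧ e ∉ clF M R₁))
    (hAset : Aset = V.filter (fun e => e ∈ clF M (insert c₂ R₁) ∧ e ∉ clF M R₁))
    (hLset : Lset = V.filter (fun e => e ∈ clF M R₁)) {y₃ : α} (hP4 : P.card = 4) (hM3 : 3 ≤ Mset.card)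
    (hM2 : 1 < Mset.card) (hP₃2 : P₃.card ≤ 2) (hMsplit : Mset.card = P₃.card + M'.card) (hM'1 : 1 ≤ M'.card)
    (hL₀2 : L₀.card ≤ 2) (hπ₂3 : (P.filter (fun e => e ∈ clF M (insert c₂ R₁))).card ≤ 3)
    (hL₀P₂ : L₀.card + P₂.card ≤ 3) (hsplit : L₀.card + P₂.card + P₃.card = 4) (hL3 : 3 ≤ Lset.card) :
    P₃.card ≤ 1 → ∃ y₃' ∈ W, y₃' ≠ y₃ ∧ (y₃' ∈ clF M (insert c₃ R₁) ∧ y₃' ∉ clF M R₁) := by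
  subst hV hP hW hMset hP₃ hM' hL₀ hP₂ hAset hLset
  set V := (G \ coloops M G) \ {w₀, x} with hV
  set P := (insert z B \ coloops M G).erase w₀ with hP
  set W := (G \ insert z B).erase x with hW
  set Mset := V.filter (fun e => e ∈ clF M (insert c₃ R₁) ∧ e ∉ clF M R₁) with hMset
  set P₃ := P.filter (fun e => e ∈ Mset) with hP₃
  set M' := W.filter (fun e => e ∈ Mset) with hM'
  set L₀ := P.filter (fun e => e ∈ clF M R₁) with hL₀
  set P₂ := P.filter (fun e => e ∈ clF M (insert c₂ R₁) ∧ e ∉ clF M R₁) with hP₂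
  set Aset := V.filter (fun e => e ∈ clF M (insert c₂ R₁) ∧ e ∉ clF M R₁) with hAset
  set Lset := V.filter (fun e => e ∈ clF M R₁) with hLset
  have _u := hd
  have _u := hk
  have _u := hfat
  have _u := hR₁2
  have _u := hR₁3
  have _u := hcop
  have _u := hnd₂
  have _u := hdeg₃
  have _u := hP4
  have _u := hM3
  have _u := hM2
  have _u := hP₃2
  have _u := hMsplit
  have _u := hM'1
  have _u := hL₀2
  have _u := hπ₂3
  have _u := hL₀P₂
  have _u := hsplit
  have _u := hL3
  intro h1
  have : 1 < M'.card := by omega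
  obtain ⟨y', hy', hyy'⟩ := Finset.exists_mem_ne this y₃
  rw [hM', Finset.mem_filter] at hy'
  exact ⟨y', hy'.1, hyy', (Finset.mem_filter.1 hy'.2).2⟩

/-- A spine point of `W` off `clF M` is an unloaded singleton under the pencil condition. -/
theorem deg_wit_singL {w₀ x : α} {R₁ : Finset α} {c₂ c₃ : α} {B : Finset α} {z : α} (hd : (gr M \ G).card = 2)
    (hk : kColoops M G = 1) (hs : ∀ e ∈ gr M, ∀ f ∈ gr M, e ≠ f → rkN M {e, f} = 2)
    (hfat : (fatClosures M 5 G 2).card ≤ 1) (hR₁V : R₁ ⊆ (G \ coloops M G) \ {w₀, x}) (hR₁2 : rkN M R₁ = 2)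
    (hR₁3 : 3 ≤ R₁.card) (hcop : rkN M (insert w₀ (insert x R₁)) ≤ 3) (hc₂V : c₂ ∈ (G \ coloops M G) \ {w₀, x})
    (hc₃V : c₃ ∈ (G \ coloops M G) \ {w₀, x}) (hc₂ : c₂ ∉ clF M R₁) (hc₃ : c₃ ∉ clF M (insert c₂ R₁))
    (hcover : ∀ e ∈ (G \ coloops M G) \ {w₀, x}, e ∈ clF M (insert c₂ R₁) ∨ e ∈ clF M (insert c₃ R₁))
    (hnd₂ : 3 ≤ rkN M (((G \ coloops M G) \ {w₀, x}).filter (fun e => e ∈ clF M (insert c₂ R₁) ∧ e ∉ clF M R₁)))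
    (hdeg₃ : rkN M (((G \ coloops M G) \ {w₀, x}).filter (fun e => e ∈ clF M (insert c₃ R₁) ∧ e ∉ clF M R₁)) ≤ 2)
    {V P W Mset P₃ M' L₀ P₂ Aset Lset : Finset α} (hV : V = (G \ coloops M G) \ {w₀, x})
    (hP : P = (insert z B \ coloops M G).erase w₀) (hW : W = (G \ insert z B).erase x)
    (hMset : Mset = V.filter (fun e => e ∈ clF M (insert c₃ R₁) ∧ e ∉ clF M R₁))
    (hP₃ : P₃ = P.filter (fun e => e ∈ Mset)) (hM' : M' = W.filter (fun e => e ∈ Mset))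
    (hL₀ : L₀ = P.filter (fun e => e ∈ clF M R₁))
    (hP₂ : P₂ = P.filter (fun e => e ∈ clF M (insert c₂ R₁) ∧ e ∉ clF M R₁))
    (hAset : Aset = V.filter (fun e => e ∈ clF M (insert c₂ R₁) ∧ e ∉ clF M R₁))
    (hLset : Lset = V.filter (fun e => e ∈ clF M R₁)) (hVg : V ⊆ gr M) (hPV : P ⊆ V) (hWV : W ⊆ V)
    (hPW : ∀ e ∈ P, e ∉ W) (hP4 : P.card = 4) (hw₀g : w₀ ∈ gr M) (hxg : x ∈ gr M) (hM3 : 3 ≤ Mset.card)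
    (hM2 : 1 < Mset.card) (hP₃2 : P₃.card ≤ 2) (hMsplit : Mset.card = P₃.card + M'.card) (hM'1 : 1 ≤ M'.card)
    (hL₀2 : L₀.card ≤ 2) (hπ₂3 : (P.filter (fun e => e ∈ clF M (insert c₂ R₁))).card ≤ 3)
    (hL₀P₂ : L₀.card + P₂.card ≤ 3) (hsplit : L₀.card + P₂.card + P₃.card = 4) (hL3 : 3 ≤ Lset.card)
    (hA3 : 3 ≤ Aset.card) :
    ∀ s ∈ W, s ∈ clF M R₁ → s ∉ clF M Mset → (∀ c ∈ P₂, ∀ c' ∈ P₂, c ≠ c' → s ∈ clF M {c, c'} → rkN M (insert w₀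
      (insert x {c, c'})) ≤ 3) → ∀ a ∈ P, ∀ b ∈ P, a ≠ b → s ∈ clF M {a, b} → rkN M (insert w₀ (insert x {a, b})) ≤
      3 := by
  subst hV hP hW hMset hP₃ hM' hL₀ hP₂ hAset hLset
  set V := (G \ coloops M G) \ {w₀, x} with hV
  set P := (insert z B \ coloops M G).erase w₀ with hP
  set W := (G \ insert z B).erase x with hW
  set Mset := V.filter (fun e => e ∈ clF M (insert c₃ R₁) ∧ e ∉ clF M R₁) with hMset
  set P₃ := P.filter (fun e => e ∈ Mset) with hP₃
  set M' := W.filter (fun e => e ∈ Mset) with hM'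
  set L₀ := P.filter (fun e => e ∈ clF M R₁) with hL₀
  set P₂ := P.filter (fun e => e ∈ clF M (insert c₂ R₁) ∧ e ∉ clF M R₁) with hP₂
  set Aset := V.filter (fun e => e ∈ clF M (insert c₂ R₁) ∧ e ∉ clF M R₁) with hAset
  set Lset := V.filter (fun e => e ∈ clF M R₁) with hLset
  have _u := hd
  have _u := hk
  have _u := hfat
  have _u := hR₁2
  have _u := hR₁3
  have _u := hcop
  have _u := hnd₂
  have _u := hdeg₃
  have _u := hP4
  have _u := hM3
  have _u := hM2
  have _u := hP₃2
  have _u := hMsplit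
  have _u := hM'1
  have _u := hL₀2
  have _u := hπ₂3
  have _u := hL₀P₂
  have _u := hsplit
  have _u := hL3
  have _u := hA3
  intro s hsW hsL hsM hcc
  apply single_class_of_spine_point hs hVg hR₁V hR₁2 hw₀g hxg hcop hc₂V hc₃V hc₂ hc₃ hcover hPV hWV hPW hsW hsL hsM
  intro c hc c' hc' hcc' hc2 hcL hc'2 hc'L
  exact hcc c (Finset.mem_filter.2 ⟨hc, hc2, hcL⟩) c' (Finset.mem_filter.2 ⟨hc', hc'2, hc'L⟩) hcc'

/-- When the line of `M` is not a non-class basis line, every side point of `W` is an unloaded singleton. -/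
theorem deg_wit_singM {w₀ x : α} {R₁ : Finset α} {c₂ c₃ : α} {B : Finset α} {z : α} (hd : (gr M \ G).card = 2)
    (hk : kColoops M G = 1) (hs : ∀ e ∈ gr M, ∀ f ∈ gr M, e ≠ f → rkN M {e, f} = 2)
    (hfat : (fatClosures M 5 G 2).card ≤ 1) (hR₁V : R₁ ⊆ (G \ coloops M G) \ {w₀, x}) (hR₁2 : rkN M R₁ = 2)
    (hR₁3 : 3 ≤ R₁.card) (hcop : rkN M (insert w₀ (insert x R₁)) ≤ 3) (hc₂V : c₂ ∈ (G \ coloops M G) \ {w₀, x})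
    (hc₃V : c₃ ∈ (G \ coloops M G) \ {w₀, x}) (hc₂ : c₂ ∉ clF M R₁) (hc₃ : c₃ ∉ clF M (insert c₂ R₁))
    (hcover : ∀ e ∈ (G \ coloops M G) \ {w₀, x}, e ∈ clF M (insert c₂ R₁) ∨ e ∈ clF M (insert c₃ R₁))
    (hnd₂ : 3 ≤ rkN M (((G \ coloops M G) \ {w₀, x}).filter (fun e => e ∈ clF M (insert c₂ R₁) ∧ e ∉ clF M R₁)))
    (hdeg₃ : rkN M (((G \ coloops M G) \ {w₀, x}).filter (fun e => e ∈ clF M (insert c₃ R₁) ∧ e ∉ clF M R₁)) ≤ 2)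
    {V P W Mset P₃ M' L₀ P₂ Aset Lset : Finset α} (hV : V = (G \ coloops M G) \ {w₀, x})
    (hP : P = (insert z B \ coloops M G).erase w₀) (hW : W = (G \ insert z B).erase x)
    (hMset : Mset = V.filter (fun e => e ∈ clF M (insert c₃ R₁) ∧ e ∉ clF M R₁))
    (hP₃ : P₃ = P.filter (fun e => e ∈ Mset)) (hM' : M' = W.filter (fun e => e ∈ Mset))
    (hL₀ : L₀ = P.filter (fun e => e ∈ clF M R₁))
    (hP₂ : P₂ = P.filter (fun e => e ∈ clF M (insert c₂ R₁) ∧ e ∉ clF M R₁))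
    (hAset : Aset = V.filter (fun e => e ∈ clF M (insert c₂ R₁) ∧ e ∉ clF M R₁))
    (hLset : Lset = V.filter (fun e => e ∈ clF M R₁)) (hVg : V ⊆ gr M) (hPV : P ⊆ V) (hWV : W ⊆ V)
    (hPW : ∀ e ∈ P, e ∉ W) (hP4 : P.card = 4) (hw₀g : w₀ ∈ gr M) (hxg : x ∈ gr M) (hM3 : 3 ≤ Mset.card)
    (hM2 : 1 < Mset.card) (hP₃2 : P₃.card ≤ 2) (hMsplit : Mset.card = P₃.card + M'.card) (hM'1 : 1 ≤ M'.card)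
    (hL₀2 : L₀.card ≤ 2) (hπ₂3 : (P.filter (fun e => e ∈ clF M (insert c₂ R₁))).card ≤ 3)
    (hL₀P₂ : L₀.card + P₂.card ≤ 3) (hsplit : L₀.card + P₂.card + P₃.card = 4) (hL3 : 3 ≤ Lset.card)
    (hA3 : 3 ≤ Aset.card) :
    (¬ (4 ≤ rkN M (insert w₀ (insert x Mset)) ∧ ∃ a ∈ P, ∃ b ∈ P, a ≠ b ∧ a ∈ clF M Mset ∧ b ∈ clF M Mset)) → ∀ y
      ∈ W, (y ∈ clF M (insert c₃ R₁) ∧ y ∉ clF M R₁) → ∀ a ∈ P, ∀ b ∈ P, a ≠ b → y ∈ clF M {a, b} → rkN M (insert w₀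
      (insert x {a, b})) ≤ 3 := by
  subst hV hP hW hMset hP₃ hM' hL₀ hP₂ hAset hLset
  set V := (G \ coloops M G) \ {w₀, x} with hV
  set P := (insert z B \ coloops M G).erase w₀ with hP
  set W := (G \ insert z B).erase x with hW
  set Mset := V.filter (fun e => e ∈ clF M (insert c₃ R₁) ∧ e ∉ clF M R₁) with hMset
  set P₃ := P.filter (fun e => e ∈ Mset) with hP₃
  set M' := W.filter (fun e => e ∈ Mset) with hM'
  set L₀ := P.filter (fun e => e ∈ clF M R₁) with hL₀
  set P₂ := P.filter (fun e => e ∈ clF M (insert c₂ R₁) ∧ e ∉ clF M R₁) with hP₂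
  set Aset := V.filter (fun e => e ∈ clF M (insert c₂ R₁) ∧ e ∉ clF M R₁) with hAset
  set Lset := V.filter (fun e => e ∈ clF M R₁) with hLset
  have _u := hd
  have _u := hk
  have _u := hfat
  have _u := hR₁2
  have _u := hR₁3
  have _u := hcop
  have _u := hnd₂
  have _u := hdeg₃
  have _u := hP4
  have _u := hM3
  have _u := hM2
  have _u := hP₃2
  have _u := hMsplit
  have _u := hM'1
  have _u := hL₀2
  have _u := hπ₂3
  have _u := hL₀P₂
  have _u := hsplit
  have _u := hL3
  have _u := hA3
  intro hM y hyW hyside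
  exact single_class_of_side_point hs hVg hR₁V hw₀g hxg hc₂V hc₃V hc₂ hc₃ hcover hPV hWV hPW hM hyW hyside.1
    hyside.2

end PercRepro.Shadow
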